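import Summits.CriticalPhenomena.PercolationContinuityZ3.Theorems.PercNearOneGluingNoHeavyLowerTailMajorityGluingTypeTableScaledClose
import Summits.CriticalPhenomena.PercolationContinuityZ3.Theorems.PercNearOneGluingNoHeavyLowerTailMajorityGluingTypeTableBottom
import HarnessLib

/-!
# Template S in the kernel: a passing case entry bounds `E ≤ M`; the cover of all laws by cases
(lane prim-rate, constants-miner 1, gen 30; KERNEL-WINDOW.md §0 (5)(i); RIGOROUS-CERTIFICATION.md §4 THEOREM BOTTOM-3)

Support file for the closed crux `NoHeavyLowerTail` (stmt-CriticalPhenomena-4575), majority-gluing line; continuation of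
`…TypeTableScaledClose`.  **`case_sound`**: if `caseCheck 240 w pat e = true` (world-A certificate + `closeA`, world-B certificate +
`closeB`, or the two all-top certificates + `close8`), then `E(x) ≤ M` for every law of the case `(w, pat)` at every hub weight
`0 < M ≤ 2^{-240/32}` — the three closing arguments fed by `3E ≤ U₄` (STAR with `θ = 0`), ISO₄ / relay ISO₃, `T_w ≤ 1`,
EIGHTH, and the certificate's objective bound.  **`bottom_of_cases`**: every law of the symmetric programme with the `O`-rows has
SOME dominant relay and SOME band pattern in `PATS3`, so case theorems for all `4 × 81` cases give **`E(x) ≤ M` for every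
`0 < M ≤ 2^{-240/32}`**.  The case theorems themselves are data (`…TypeTableScaledCertW*`), the assembly is `…TypeTableScaledBottom`.
No percolation, no sorries.  [cite: VandenbergHaggstromKahn2005, Thm. 1.3 (p. 6)]
-/

namespace Summit.CriticalPhenomena.PercolationContinuityZ3.Theorems

namespace HubOnly
namespace TypeTable

open DType

noncomputable section

variable {K : ℕ} {M : ℝ} {x : DType → ℝ} {cs : SCase}

/-! ### Law-level inputs of the closing arguments -/

/-- `3E ≤ U₄` from STAR_z with `θ = 0` (`S_z ≤ 2T_z`) — `x(all cut) > 0` because `T₁T₂ ≤ x(C₁₂)x(all cut)` with positive layers. -/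
theorem threeE_le_U (L : SLaw K cs M x) {z : ℕ} (hz : z ∈ [1, 2, 3, 4]) (hrich : Sm z x ≤ 2 * Tm z x) :
    3 * E x ≤ uS [1, 2, 3, 4] x := by
  have hx := L.nonneg
  obtain ⟨hB2, -, -⟩ := L.budgets
  have hT := L.Tpos z hz
  have hrich' : Sm z x ≤ (2 - 0) * Tm z x := by linarith
  have m1 : (1:ℕ) ∈ [1, 2, 3, 4] := by simp
  have m2 : (2:ℕ) ∈ [1, 2, 3, 4] := by simp
  have m3 : (3:ℕ) ∈ [1, 2, 3, 4] := by simp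
  have m4 : (4:ℕ) ∈ [1, 2, 3, 4] := by simp
  have hApos : 0 < ACm x := by
    have h12 := L.hub 1 m1 2 m2 (by norm_num)
    have hC : 0 ≤ Cm 1 2 x := lin_ind_nonneg _ hx
    have hA : 0 ≤ ACm x := lin_ind_nonneg _ hx
    by_contra hA0
    have hA0' : ACm x = 0 := le_antisymm (not_lt.mp hA0) hA
    rw [hA0', mul_zero] at h12
    have := mul_pos (L.Tpos 1 m1) (L.Tpos 2 m2)
    linarith
  have key : ∀ {P : ℝ}, ACm x * (3 * E x) ≤ ACm x * uS [1, 2, 3, 4] x - 0 * P → 3 * E x ≤ uS [1, 2, 3, 4] x := by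
    intro P h
    rw [zero_mul, sub_zero] at h
    exact le_of_mul_le_mul_left h hApos
  simp only [List.mem_cons, List.not_mem_nil, or_false] at hz
  rcases hz with rfl | rfl | rfl | rfl
  · exact key (star1_theta x hx le_rfl hT hrich' hB2 (L.ordRows _ (by simp [linOrd])) (L.ordRows _ (by simp [linOrd]))
      (L.ordRows _ (by simp [linOrd])) (L.hub 1 m1 2 m2 (by norm_num)) (L.hub 1 m1 3 m3 (by norm_num))
      (L.hub 1 m1 4 m4 (by norm_num)) (L.rel 1 m1 2 m2 (by norm_num)) (L.rel 1 m1 3 m3 (by norm_num))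
      (L.rel 1 m1 4 m4 (by norm_num)))
  · exact key (star2_theta x hx le_rfl hT hrich' (L.linRows _ (by simp [linFree])) (L.linRows _ (by simp [linFree]))
      (L.linRows _ (by simp [linFree])) (L.hub 2 m2 1 m1 (by norm_num)) (L.hub 2 m2 3 m3 (by norm_num))
      (L.hub 2 m2 4 m4 (by norm_num)) (L.rel 2 m2 1 m1 (by norm_num)) (L.rel 2 m2 3 m3 (by norm_num))
      (L.rel 2 m2 4 m4 (by norm_num)))
  · exact key (star3_theta x hx le_rfl hT hrich' (L.linRows _ (by simp [linFree])) (L.linRows _ (by simp [linFree]))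
      (L.linRows _ (by simp [linFree])) (L.hub 3 m3 1 m1 (by norm_num)) (L.hub 3 m3 2 m2 (by norm_num))
      (L.hub 3 m3 4 m4 (by norm_num)) (L.rel 3 m3 1 m1 (by norm_num)) (L.rel 3 m3 2 m2 (by norm_num))
      (L.rel 3 m3 4 m4 (by norm_num)))
  · exact key (star4_theta x hx le_rfl hT hrich' (L.linRows _ (by simp [linFree])) (L.linRows _ (by simp [linFree]))
      (L.linRows _ (by simp [linFree])) (L.hub 4 m4 1 m1 (by norm_num)) (L.hub 4 m4 2 m2 (by norm_num))
      (L.hub 4 m4 3 m3 (by norm_num)) (L.rel 4 m4 1 m1 (by norm_num)) (L.rel 4 m4 2 m2 (by norm_num))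
      (L.rel 4 m4 3 m3 (by norm_num)))

/-- Every layer is at most one: `T_w ≤ x(v₁ cut) ≤ 1` (`T₁ ≤ x(v₂ cut) ≤ x(v₁ cut)` by the budget). -/
theorem T_le_cut : ∀ τ ∈ allTypes, (∀ w ∈ [2, 3, 4], ind (τ.isT w) ≤ τ.cutZ 1) ∧ ind (τ.isT 1) ≤ τ.cutZ 2 := by decide +kernel

/-- `T_w ≤ 1` for every relay of a case law. -/
theorem Tm_le_one (L : SLaw K cs M x) {w : ℕ} (hw : w ∈ [1, 2, 3, 4]) : Tm w x ≤ 1 := by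
  have hx := L.nonneg
  have hn := L.norm
  obtain ⟨hB2, -, -⟩ := L.budgets
  simp only [List.mem_cons, List.not_mem_nil, or_false] at hw
  rcases hw with rfl | hw'
  · have h1 : Tm 1 x ≤ lin (fun τ => τ.cutZ 2) x := lin_mono (fun τ hτ => (T_le_cut τ hτ).2) hx
    have h2 : lin (fun τ => τ.bud 2) x = lin (fun τ => τ.cutZ 2) x - lin (fun τ => τ.cutZ 1) x := by
      have h := lin_combo [(1, fun τ => τ.cutZ 2), (-1, fun τ => τ.cutZ 1)] x
      simp only [List.map_cons, List.map_nil, List.sum_cons, List.sum_nil, add_zero] at h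
      push_cast at h
      have e : lin (fun τ => τ.bud 2) x = lin (combo [(1, fun τ => τ.cutZ 2), (-1, fun τ => τ.cutZ 1)]) x :=
        lin_congr (fun τ _ => by simp [combo, DType.bud]; ring) x
      rw [e, h]; ring
    linarith
  · have hw2 : w ∈ [2, 3, 4] := by simp only [List.mem_cons, List.not_mem_nil, or_false]; exact hw'
    have h1 : Tm w x ≤ lin (fun τ => τ.cutZ 1) x := lin_mono (fun τ hτ => (T_le_cut τ hτ).1 w hw2) hx
    linarith

/-- On `LARGE_w` there is no `S_z` / `T_z` type of another relay `z ≠ w`. -/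
theorem st_small : ∀ τ ∈ allTypes, ∀ w ∈ [1, 2, 3, 4], ∀ z ∈ [1, 2, 3, 4], z ≠ w → τ.large w = true →
    τ.isS z = false ∧ τ.isT z = false := by decide +kernel

/-- Masses of the other relays are the same for the restricted and the unrestricted scaled law. -/
theorem st_restrict_eq (K : ℕ) (M : ℝ) (x : DType → ℝ) {w z : ℕ} (hw : w ∈ [1, 2, 3, 4]) (hz : z ∈ [1, 2, 3, 4]) (hzw : z ≠ w) :
    Sm z (xs true K M w x) = Sm z (xs false K M w x) ∧ Tm z (xs true K M w x) = Tm z (xs false K M w x) := by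
  have key : ∀ (A : DType → Bool), (∀ τ ∈ allTypes, τ.large w = true → A τ = false) →
      lin (fun τ => ind (A τ)) (xs true K M w x) = lin (fun τ => ind (A τ)) (xs false K M w x) := by
    intro A hA
    unfold lin
    apply congrArg
    apply List.map_congr_left
    intro τ hτ
    by_cases hl : τ.large w = true
    · simp [xs, hl, hA τ hτ hl, ind]
    · simp [xs, hl]
  exact ⟨key _ (fun τ hτ hl => (st_small τ hτ w hw z hz hzw hl).1), key _ (fun τ hτ hl => (st_small τ hτ w hw z hz hzw hl).2)⟩

/-! ### The three case soundness theorems -/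

/-- `2 < c₄ ≤ 3`, `1 ≤ s₀`. -/
theorem c4_s0_facts : 2 < (3 + Real.sqrt (11 / 3)) / 2 ∧ (3 + Real.sqrt (11 / 3)) / 2 ≤ 3 ∧ 1 ≤ s0 :=
  ⟨c4_bounds.1, c4_bounds.2.le, one_lt_s0'.le⟩

/-- **World A**: a passing world-A certificate and `closeA` give `E ≤ M`. -/
theorem caseA_sound (L : SLaw 240 cs M x) {c : SCert} (hchk : checkS 240 cs .A c = true) (hcl : closeA 240 c.V = true) :
    E x ≤ M := by
  have hx := L.nonneg
  obtain ⟨hc2, hc3, hs⟩ := c4_s0_facts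
  -- unpack the check
  have h := hchk
  unfold checkS at h
  simp only [Bool.and_eq_true, decide_eq_true_eq] at h
  obtain ⟨⟨⟨⟨⟨⟨⟨hWok, _⟩, hobj⟩, _⟩, _⟩, hV0⟩, _⟩, _⟩ := h
  -- a relay with r ≤ 1 ⟹ 3E ≤ U
  simp only [SWorld.ok, Bool.and_eq_true, decide_eq_true_eq, List.any_eq_true] at hWok
  obtain ⟨_, z, hz, hzr⟩ := hWok
  have h3E : 3 * E x ≤ uS [1, 2, 3, 4] x := by
    cases hh : (cs.bandOf z).hi with
    | none => simp [hh] at hzr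
    | some hq =>
      simp only [hh, decide_eq_true_eq] at hzr
      have hb := L.bandHi z hz hq hh
      have hT := (L.Tpos z hz).le
      have hq1 : (hq : ℝ) ≤ 1 := by exact_mod_cast hzr
      exact threeE_le_U L hz (by nlinarith)
  -- the product bound from the objective
  have hobjle := objective_le L hchk
  obtain ⟨hnn, -⟩ := xs_nonneg_supp false cs.w hx L.Mpos L.Mle (K := 240)
  have hp := prodA_le hnn hobj hobjle
  have e : ∀ z, Sm z (xs false 240 M cs.w x) + Tm z (xs false 240 M cs.w x) = scal 240 M * (Sm z x + Tm z x) := fun z => by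
    simp only [Sm, Tm, lin_xs]; ring
  rw [e 1, e 2, e 3, e 4] at hp
  set P := (Sm 1 x + Tm 1 x) * (Sm 2 x + Tm 2 x) * (Sm 3 x + Tm 3 x) * (Sm 4 x + Tm 4 x) with hP
  have hprod : ((Mtop 240 / M) ^ s0) ^ 4 * P ≤ (((c.V / NOBJ : ℚ)) : ℝ) ^ 4 := by
    have e2 : ((Mtop 240 / M) ^ s0) ^ 4 * P = scal 240 M * (Sm 1 x + Tm 1 x) * (scal 240 M * (Sm 2 x + Tm 2 x)) *
        (scal 240 M * (Sm 3 x + Tm 3 x)) * (scal 240 M * (Sm 4 x + Tm 4 x)) := by simp only [scal, hP]; ring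
    rw [e2]; refine hp.trans (le_of_eq ?_); push_cast; ring
  have hiso : uS [1, 2, 3, 4] x ^ ((3 + Real.sqrt (11 / 3)) / 2) ≤ M ^ (4 - (3 + Real.sqrt (11 / 3)) / 2) * P := by
    calc _ ≤ _ := L.iso4
      _ = _ := by rw [hP]; ring
  exact closeA_real L.Mpos L.Mle hs hc2 hc3 h3E hiso hprod (closeA_W4 hV0 hcl)

/-- **World B**: a passing world-B certificate and `closeB` (with the dominant relay's upper band edge `h`) give `E ≤ M`. -/
theorem caseB_sound (L : SLaw 240 cs M x) {c : SCert} (hchk : checkS 240 cs .B c = true) {h : ℚ}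
    (hh : (cs.bandOf cs.w).hi = some h) (hcl : closeB 240 h c.V = true) : E x ≤ M := by
  have hx := L.nonneg
  have hw := L.wmem
  obtain ⟨hc2, hc3, hs⟩ := c4_s0_facts
  have hck := hchk
  unfold checkS at hck
  simp only [Bool.and_eq_true, decide_eq_true_eq] at hck
  obtain ⟨⟨⟨⟨⟨⟨⟨hWok, _⟩, hobj⟩, _⟩, _⟩, hV0⟩, _⟩, _⟩ := hck
  simp only [SWorld.ok, Bool.and_eq_true, decide_eq_true_eq] at hWok
  obtain ⟨_, hcode⟩ := hWok
  obtain ⟨cd, hcd⟩ := Option.isSome_iff_exists.mp hcode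
  -- r_w ≤ 1 ⟹ 3E ≤ U
  have hhi := band_tcode _ cd hcd
  have hhi' : (cs.bandOf cs.w).hi = some (1 - (1 / 2) ^ cd) := hhi
  rw [hh] at hhi'
  have hqeq : h = 1 - (1 / 2) ^ cd := Option.some.inj hhi'
  have hband := L.bandHi cs.w hw h hh
  have hTw := L.Tpos cs.w hw
  have hTw1 := Tm_le_one L hw
  have hh1 : (h : ℝ) ≤ 1 := by
    rw [hqeq]; push_cast
    have : (0 : ℝ) ≤ (1 / 2) ^ cd := by positivity
    linarith
  have h3E : 3 * E x ≤ uS [1, 2, 3, 4] x := threeE_le_U L hw (by nlinarith)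
  have hSw0 : 0 ≤ Sm cs.w x := lin_ind_nonneg _ hx
  have h2h : (0 : ℝ) ≤ 2 + h := by nlinarith
  -- the product bound (restricted law; the other relays' masses are unrestricted)
  have hobjle := objective_le L hchk
  obtain ⟨hnn, -⟩ := xs_nonneg_supp true cs.w hx L.Mpos L.Mle (K := 240)
  obtain ⟨a, b, d, he, hp⟩ := prodB_le hnn hw hobj hobjle
  obtain ⟨a', b', d', he', ha, hb, hd, haw, hbw, hdw, hregroup⟩ := othersOf_spec hw (fun z => Sm z x + Tm z x)
  rw [he] at he'
  obtain ⟨rfl, rfl, rfl⟩ : a = a' ∧ b = b' ∧ d = d' := by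
    simp only [List.cons.injEq, and_true] at he'; exact ⟨he'.1, he'.2.1, he'.2.2⟩
  have e : ∀ z ∈ [1, 2, 3, 4], z ≠ cs.w →
      Sm z (xs true 240 M cs.w x) + Tm z (xs true 240 M cs.w x) = scal 240 M * (Sm z x + Tm z x) := by
    intro z hz hzw
    obtain ⟨e1, e2⟩ := st_restrict_eq 240 M x hw hz hzw
    rw [e1, e2]; simp only [Sm, Tm, lin_xs]; ring
  rw [e a ha haw, e b hb hbw, e d hd hdw] at hp
  set P3 := (Sm a x + Tm a x) * (Sm b x + Tm b x) * (Sm d x + Tm d x) with hP3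
  have hP30 : 0 ≤ P3 := by
    have := lin_ind_nonneg (fun τ => τ.isS a) hx; have := lin_ind_nonneg (fun τ => τ.isT a) hx
    have := lin_ind_nonneg (fun τ => τ.isS b) hx; have := lin_ind_nonneg (fun τ => τ.isT b) hx
    have := lin_ind_nonneg (fun τ => τ.isS d) hx; have := lin_ind_nonneg (fun τ => τ.isT d) hx
    simp only [Sm, Tm] at *; positivity
  have hprod : ((Mtop 240 / M) ^ s0) ^ 3 * P3 ≤ (((c.V / NOBJ : ℚ)) : ℝ) ^ 3 := by
    have e2 : ((Mtop 240 / M) ^ s0) ^ 3 * P3 = scal 240 M * (Sm a x + Tm a x) * (scal 240 M * (Sm b x + Tm b x)) *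
        (scal 240 M * (Sm d x + Tm d x)) := by simp only [scal, hP3]; ring
    rw [e2]; refine hp.trans (le_of_eq ?_); push_cast; ring
  have hiso : uS [1, 2, 3, 4] x ^ ((3 + Real.sqrt (11 / 3)) / 2) ≤
      M ^ (4 - (3 + Real.sqrt (11 / 3)) / 2) * (Sm cs.w x + Tm cs.w x) * P3 := by
    calc _ ≤ _ := L.iso4
      _ = M ^ (4 - (3 + Real.sqrt (11 / 3)) / 2) *
          ((Sm 1 x + Tm 1 x) * (Sm 2 x + Tm 2 x) * (Sm 3 x + Tm 3 x) * (Sm 4 x + Tm 4 x)) := by ring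
      _ = _ := by rw [hregroup, hP3]; ring
  exact closeB_real L.Mpos L.Mle hs hc2 hc3 hP30 hTw1 h2h (by linarith : Sm cs.w x + Tm cs.w x ≤ (2 + (h : ℝ)) * Tm cs.w x)
    h3E hiso hprod (closeB_W3 hV0 (by exact_mod_cast h2h) hcl)

/-- **All-top**: the two relay-triple certificates and `close8` give `E ≤ M` (EIGHTH + relay ISO₃). -/
theorem caseTop_sound (L : SLaw 240 cs M x) {c1 c2 : SCert} {Y1 Y2 : ℚ} (h1 : checkS 240 cs (.top [1, 2, 3]) c1 = true)
    (h2 : checkS 240 cs (.top [1, 2, 4]) c2 = true) (hcl : close8 240 c1.V c2.V Y1 Y2 = true) : E x ≤ M := by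
  have hx := L.nonneg
  obtain ⟨hB2, -, -⟩ := L.budgets
  -- EIGHTH
  have h8 := eighth x hx hB2 (L.linRows _ (by simp [linFree])) (L.linRows _ (by simp [linFree]))
    (L.linRows _ (by simp [linFree])) (L.linRows _ (by simp [linFree])) (L.linRows _ (by simp [linFree]))
    (L.ordRows _ (by simp [linOrd])) (L.ordRows _ (by simp [linOrd]))
  -- unpack the checks
  have u1 := h1; have u2 := h2
  unfold checkS at u1 u2
  simp only [Bool.and_eq_true, decide_eq_true_eq] at u1 u2
  obtain ⟨⟨⟨⟨⟨⟨⟨_, _⟩, hobj1⟩, _⟩, _⟩, hV1⟩, _⟩, _⟩ := u1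
  obtain ⟨⟨⟨⟨⟨⟨⟨_, _⟩, hobj2⟩, _⟩, _⟩, hV2⟩, _⟩, _⟩ := u2
  obtain ⟨hnn, -⟩ := xs_nonneg_supp false cs.w hx L.Mpos L.Mle (K := 240)
  have o1 := objective_le L h1
  have o2 := objective_le L h2
  have p1 := prodTop_le hnn hobj1 o1
  have p2 := prodTop_le hnn hobj2 o2
  simp only [lin_xs] at p1 p2
  obtain ⟨hc3pos, hql3, -, -, -⟩ := c3_facts
  have hc1 : 1 < (3 + Real.sqrt 3) / 2 := by
    have := RpowCert.sqrt3_bounds.1; linarith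
  have hq : (19 : ℝ) / 45 ≤ ((3 + Real.sqrt 3) / 2)⁻¹ := by
    have e1 : ((QL3 : ℚ) : ℝ) = 422649730810 / 10 ^ 12 := by norm_num [QL3]
    rw [e1] at hql3; linarith
  obtain ⟨hW10, hW20, hY1, hY2, hsum⟩ := close8_Y hV1 hV2 hcl
  set R : ℕ → ℝ := fun t => lin (fun τ => ind (τ.rho [1, 2, 3] t)) x with hR
  set R' : ℕ → ℝ := fun t => lin (fun τ => ind (τ.rho [1, 2, 4] t)) x with hR'
  have iso1 : uS [1, 2, 3] x ^ ((3 + Real.sqrt 3) / 2) ≤ M ^ (3 - (3 + Real.sqrt 3) / 2) * (R 1 * R 2 * R 3) := by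
    calc _ ≤ _ := L.isoR 1 (by simp) 2 (by simp) 3 (by simp) (by norm_num) (by norm_num) (by norm_num)
      _ = _ := by simp only [hR]; ring
  have iso2 : uS [1, 2, 4] x ^ ((3 + Real.sqrt 3) / 2) ≤ M ^ (3 - (3 + Real.sqrt 3) / 2) * (R' 1 * R' 2 * R' 4) := by
    calc _ ≤ _ := L.isoR 1 (by simp) 2 (by simp) 4 (by simp) (by norm_num) (by norm_num) (by norm_num)
      _ = _ := by simp only [hR']; ring
  have hprod1 : ((Mtop 240 / M) ^ s0) ^ 3 * (R 1 * R 2 * R 3) ≤ (((c1.V / NOBJ : ℚ)) : ℝ) ^ 3 := by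
    have e2 : ((Mtop 240 / M) ^ s0) ^ 3 * (R 1 * R 2 * R 3) = scal 240 M * R 1 * (scal 240 M * R 2) * (scal 240 M * R 3) := by
      simp only [scal]; ring
    rw [e2]; refine p1.trans (le_of_eq ?_); push_cast; ring
  have hprod2 : ((Mtop 240 / M) ^ s0) ^ 3 * (R' 1 * R' 2 * R' 4) ≤ (((c2.V / NOBJ : ℚ)) : ℝ) ^ 3 := by
    have e2 : ((Mtop 240 / M) ^ s0) ^ 3 * (R' 1 * R' 2 * R' 4) = scal 240 M * R' 1 * (scal 240 M * R' 2) * (scal 240 M * R' 4) := by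
      simp only [scal]; ring
    rw [e2]; refine p2.trans (le_of_eq ?_); push_cast; ring
  exact close8_real L.Mpos L.Mle c4_s0_facts.2.2 hc1 hq (lin_ind_nonneg _ hx) (lin_ind_nonneg _ hx) hW10 hW20
    h8 iso1 iso2 hprod1 hprod2 hY1 hY2 hsum

/-! ### Case soundness -/

/-- THE STATEMENT a case theorem establishes: every law of the case `(w, pat)` at every hub weight `0 < M ≤ 2^{-240/32}` has `E ≤ M`. -/
def CaseHolds (w : ℕ) (pat : List ℕ) : Prop :=
  ∀ (M : ℝ) (x : DType → ℝ), SLaw 240 ⟨w, pat⟩ M x → E x ≤ M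

/-- **CASE SOUNDNESS.**  A passing case entry closes the case. -/
theorem case_sound {w : ℕ} {pat : List ℕ} {e : CEntry} (h : caseCheck 240 w pat e = true) : CaseHolds w pat := by
  intro M x L
  cases e with
  | a c =>
    simp only [caseCheck, Bool.and_eq_true] at h
    exact caseA_sound L h.1 h.2
  | b c =>
    simp only [caseCheck, Bool.and_eq_true] at h
    obtain ⟨h1, h2⟩ := h
    split at h2
    · rename_i hq hh
      exact caseB_sound L h1 hh h2
    · simp at h2
  | top c1 c2 Y1 Y2 =>
    simp only [caseCheck, Bool.and_eq_true] at h
    exact caseTop_sound L h.1.1 h.1.2 h.2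

/-! ### The cover: every law belongs to some case -/

/-- The 81 band patterns over the three bands (lexicographic). -/
def PATS3 : List (List ℕ) :=
  [[0, 0, 0, 0], [0, 0, 0, 1], [0, 0, 0, 2], [0, 0, 1, 0], [0, 0, 1, 1], [0, 0, 1, 2], [0, 0, 2, 0], [0, 0, 2, 1], [0, 0, 2, 2],
   [0, 1, 0, 0], [0, 1, 0, 1], [0, 1, 0, 2], [0, 1, 1, 0], [0, 1, 1, 1], [0, 1, 1, 2], [0, 1, 2, 0], [0, 1, 2, 1], [0, 1, 2, 2],
   [0, 2, 0, 0], [0, 2, 0, 1], [0, 2, 0, 2], [0, 2, 1, 0], [0, 2, 1, 1], [0, 2, 1, 2], [0, 2, 2, 0], [0, 2, 2, 1], [0, 2, 2, 2],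
   [1, 0, 0, 0], [1, 0, 0, 1], [1, 0, 0, 2], [1, 0, 1, 0], [1, 0, 1, 1], [1, 0, 1, 2], [1, 0, 2, 0], [1, 0, 2, 1], [1, 0, 2, 2],
   [1, 1, 0, 0], [1, 1, 0, 1], [1, 1, 0, 2], [1, 1, 1, 0], [1, 1, 1, 1], [1, 1, 1, 2], [1, 1, 2, 0], [1, 1, 2, 1], [1, 1, 2, 2],
   [1, 2, 0, 0], [1, 2, 0, 1], [1, 2, 0, 2], [1, 2, 1, 0], [1, 2, 1, 1], [1, 2, 1, 2], [1, 2, 2, 0], [1, 2, 2, 1], [1, 2, 2, 2],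
   [2, 0, 0, 0], [2, 0, 0, 1], [2, 0, 0, 2], [2, 0, 1, 0], [2, 0, 1, 1], [2, 0, 1, 2], [2, 0, 2, 0], [2, 0, 2, 1], [2, 0, 2, 2],
   [2, 1, 0, 0], [2, 1, 0, 1], [2, 1, 0, 2], [2, 1, 1, 0], [2, 1, 1, 1], [2, 1, 1, 2], [2, 1, 2, 0], [2, 1, 2, 1], [2, 1, 2, 2],
   [2, 2, 0, 0], [2, 2, 0, 1], [2, 2, 0, 2], [2, 2, 1, 0], [2, 2, 1, 1], [2, 2, 1, 2], [2, 2, 2, 0], [2, 2, 2, 1], [2, 2, 2, 2]]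

/-- Every 4-tuple of band indices `< 3` is in `PATS3`. -/
theorem mem_PATS3 : ∀ a ∈ [0, 1, 2], ∀ b ∈ [0, 1, 2], ∀ c ∈ [0, 1, 2], ∀ d ∈ [0, 1, 2], [a, b, c, d] ∈ PATS3 := by decide

/-- The band index of a relay in a law: `0` if `S_z ≤ (3/2)T_z`, `1` if `S_z ≤ 2T_z`, else `2`. -/
def bandIdx (x : DType → ℝ) (z : ℕ) : ℕ :=
  if Sm z x ≤ 3 / 2 * Tm z x then 0 else if Sm z x ≤ 2 * Tm z x then 1 else 2

/-- The band index is `< 3` and the law satisfies the band's edges. -/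
theorem bandIdx_spec {x : DType → ℝ} (hx : ∀ τ, 0 ≤ x τ) (z : ℕ) :
    bandIdx x z ∈ [0, 1, 2] ∧ (1 + ((band (bandIdx x z)).lo : ℝ)) * Tm z x ≤ Sm z x ∧
      ∀ h : ℚ, (band (bandIdx x z)).hi = some h → Sm z x ≤ (1 + (h : ℝ)) * Tm z x := by
  have hS : 0 ≤ Sm z x := lin_ind_nonneg _ hx
  unfold bandIdx
  split
  · refine ⟨by simp, by simp [band, BANDS]; linarith, fun h hh => ?_⟩
    simp [band, BANDS] at hh; subst hh; push_cast; linarith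
  · split
    · refine ⟨by simp, by simp [band, BANDS]; linarith, fun h hh => ?_⟩
      simp [band, BANDS] at hh; subst hh; push_cast; linarith
    · refine ⟨by simp, by simp [band, BANDS]; linarith, fun h hh => ?_⟩
      simp [band, BANDS] at hh

/-- **THE COVER.**  If every case `(w, pat)`, `w ∈ {1,2,3,4}`, `pat ∈ PATS3`, holds, then EVERY law with the symmetric hypotheses
and the `O`-rows at a hub weight `0 < M ≤ 2^{-240/32}` has `E(x) ≤ M`. -/
theorem bottom_of_cases (H : ∀ w ∈ [1, 2, 3, 4], ∀ pat ∈ PATS3, CaseHolds w pat) {M : ℝ} {x : DType → ℝ}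
    (L : SymLaw 240 M x) (O : ∀ φ ∈ linOrd, lin φ x ≤ 0) : E x ≤ M := by
  by_cases hE : E x ≤ 0
  · exact hE.trans L.Mpos.le
  push Not at hE
  obtain ⟨w, hw, hdom⟩ := exists_dominant x
  set pat : List ℕ := [bandIdx x 1, bandIdx x 2, bandIdx x 3, bandIdx x 4] with hpat
  have hmem : pat ∈ PATS3 := mem_PATS3 _ (bandIdx_spec L.nonneg 1).1 _ (bandIdx_spec L.nonneg 2).1 _
    (bandIdx_spec L.nonneg 3).1 _ (bandIdx_spec L.nonneg 4).1
  refine H w hw pat hmem M x ⟨L, O, hE, hw, hdom, ?_, ?_⟩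
  · intro z hz
    have hb : (⟨w, pat⟩ : SCase).bandOf z = band (bandIdx x z) := by
      simp only [List.mem_cons, List.not_mem_nil, or_false] at hz
      rcases hz with rfl | rfl | rfl | rfl <;> simp [SCase.bandOf, hpat]
    rw [hb]; exact (bandIdx_spec L.nonneg z).2.1
  · intro z hz h hh
    have hb : (⟨w, pat⟩ : SCase).bandOf z = band (bandIdx x z) := by
      simp only [List.mem_cons, List.not_mem_nil, or_false] at hz
      rcases hz with rfl | rfl | rfl | rfl <;> simp [SCase.bandOf, hpat]
    rw [hb] at hh; exact (bandIdx_spec L.nonneg z).2.2 h hh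

end

end TypeTable
end HubOnly

end Summit.CriticalPhenomena.PercolationContinuityZ3.Theorems
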